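import Summits.CriticalPhenomena.PercolationContinuityZ3.Theorems.Transplant.SkelSignClosureRef
import Summits.CriticalPhenomena.PercolationContinuityZ3.Theorems.Transplant.SkelSign1Choice
import HarnessLib

/-!
# D″ node, OPTION C (DPRIME-SCOPE addendum N.8 (C4), side track): the MULTI-TYPE closure in shared-choice form — the same choice DATA
# `PlanarSkeletonSign.Choice κ Φ t p hC` (p252449) read over ALL frame types: `Choice.AtQAll` (the Step-I′ family over
# `StepI.index Φ.types …`), `WFHoldsAll / RootHoldsAll / FaceHoldsRAll / ReachHoldsRHAll`, `ChoiceFnAll` (no `Φ.types = {t}` binder), the four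
# `…HoldsFnAll`, and **`samePDropOfSkeletonSign_of_choiceFnAll`** (via `samePDropOfSkeletonSign_of_concSG_residuesRH'`) — so the
# multi-type conjecture node `SamePDropOfSkeletonSign` is closed by the same three residues once they are instantiated for a `ChoiceFnAll`

builds on p205010 (kernel theorem, internal audit signed; external expert review pending) — nothing in this file uses p205010.
Lane `prim-bschramm`, seat `prim-bschramm-p3` (gen 7; D″ design owner); helper file (`--supports stmt-CriticalPhenomena-4575`).
[cite: KozmaNitzan2024, §4 Theorem 6 (pp. 25–31); §1 p. 2 (approach 1)]
-/

noncomputable section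

open MeasureTheory ProbabilityTheory
open scoped ENNReal Classical

namespace Summit.CriticalPhenomena.PercolationContinuityZ3.Theorems.Transplant

open Literature.Probability.Percolation Literature.Probability.LatticeModels SimpleGraph KNCells
open Literature.Barriers.CriticalPhenomena (HasExponentialGrowth)
open BoxProdZ2 (ConcRadiiG)

namespace PlanarSkeletonSign

open SkelConc (Consts)

variable {V : Type} [DecidableEq V] [Countable V] {G : SimpleGraph V} [G.LocallyFinite]

namespace Choice

variable {κ : Consts} {Φ : PlanarSkeletonSign G} {t : V} {p : unitInterval} {hC : Φ.CylSubcritical p}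

/-- **The premises of step (B) at `q`, ALL TYPES**: as `AtQ` but the Step-I′ family runs over `StepI.index Φ.types …`. [this work] -/
def AtQAll (𝒞 : Choice κ Φ t p hC) (O : Skelφ.StepI.Out V) (q : unitInterval) : Prop :=
  O.Facts Φ.frame hC 𝒞.m₀ ∧ Skelφ.StepI.MonoAbove O.D ∧ Skelφ.StepI.TwoUnitL O.D ∧ (p : ℝ) / 2 ≤ q ∧ (q : ℝ) ≤ p ∧
    (∀ i ∈ Skelφ.StepI.index Φ.types (𝒞.Sz O) (𝒞.Sx O) (𝒞.Sy O),
      1 - 𝒞.δI < (bondPercolation G q).real (Skelφ.StepI.event G Φ.φ O.D i)) ∧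
    Φ.CylSubcritical q

/-- The all-types premise implies the single-type premise (the family over `{t}` is a sub-family). [folklore] -/
theorem AtQAll.atQ {𝒞 : Choice κ Φ t p hC} {O : Skelφ.StepI.Out V} {q : unitInterval} (ht : t ∈ Φ.types) (h : 𝒞.AtQAll O q) :
    𝒞.AtQ O q := by
  obtain ⟨hF, hmo, htw, hq1, hq2, hin, hCq⟩ := h
  refine ⟨hF, hmo, htw, hq1, hq2, fun i hi => hin i ?_, hCq⟩
  simp only [Skelφ.StepI.index, Finset.mem_product] at hi ⊢
  exact ⟨by rw [Finset.mem_singleton.1 hi.1]; exact ht, hi.2⟩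

/-- Well-formedness, all types. [this work] -/
def WFHoldsAll (𝒞 : Choice κ Φ t p hC) : Prop :=
  ∀ (O : Skelφ.StepI.Out V) (q : unitInterval), 𝒞.AtQAll O q → Skelφ.WFS2 (𝒞.P O) (𝒞.Λ O q) ∧ κ.K₀ ≤ (𝒞.P O).K

/-- Root residue, all types. [this work] -/
def RootHoldsAll (𝒞 : Choice κ Φ t p hC) : Prop :=
  ∀ (O : Skelφ.StepI.Out V) (q : unitInterval), 𝒞.AtQAll O q → Skel.RootOblT G (𝒞.scheme O q) Φ.Δ κ.δr

/-- Face residue, all types. [this work] -/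
def FaceHoldsRAll (𝒞 : Choice κ Φ t p hC) : Prop :=
  ∀ (O : Skelφ.StepI.Out V) (q : unitInterval), 𝒞.AtQAll O q → Skelφ.FaceOblR G Φ.φ (𝒞.scheme O q) (𝒞.faces O q) Φ.Δ κ.δ₂

/-- Corridor residue, all types. [this work] -/
def ReachHoldsRHAll (𝒞 : Choice κ Φ t p hC) : Prop :=
  ∀ (O : Skelφ.StepI.Out V) (q : unitInterval), 𝒞.AtQAll O q → Skel.ReachOblRH G (𝒞.scheme O q) (𝒞.faces O q) Φ.Δ κ.δ

/-- A single-type obligation serves the all-types one (the premise is stronger). [folklore] -/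
theorem wfHoldsAll_of_wfHolds {𝒞 : Choice κ Φ t p hC} (ht : t ∈ Φ.types) (h : 𝒞.WFHolds) : 𝒞.WFHoldsAll :=
  fun O q hat => h O q (hat.atQ ht)

/-- Idem, root. [folklore] -/
theorem rootHoldsAll_of_rootHolds {𝒞 : Choice κ Φ t p hC} (ht : t ∈ Φ.types) (h : 𝒞.RootHolds) : 𝒞.RootHoldsAll :=
  fun O q hat => h O q (hat.atQ ht)

/-- Idem, faces. [folklore] -/
theorem faceHoldsRAll_of_faceHoldsR {𝒞 : Choice κ Φ t p hC} (ht : t ∈ Φ.types) (h : 𝒞.FaceHoldsR) : 𝒞.FaceHoldsRAll :=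
  fun O q hat => h O q (hat.atQ ht)

/-- Idem, corridors. [folklore] -/
theorem reachHoldsRHAll_of_reachHoldsRH {𝒞 : Choice κ Φ t p hC} (ht : t ∈ Φ.types) (h : 𝒞.ReachHoldsRH) : 𝒞.ReachHoldsRHAll :=
  fun O q hat => h O q (hat.atQ ht)

end Choice

/-- **A multi-type D″ choice function**: choices for every `κ` and every admissible CENTRED `(G, Φ, t, p, hC)` with `G` NOT of exponential growth
(NO `Φ.types = {t}` binder). [this work] -/
def ChoiceFnAll : Type 1 :=
  ∀ (κ : Consts) {V : Type} [DecidableEq V] [Countable V] (G : SimpleGraph V) [G.LocallyFinite] (Φ : PlanarSkeletonSign G),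
    ¬ HasExponentialGrowth G → ∀ (t : V), t ∈ Φ.types → Φ.φ t = 0 → ∀ (p : unitInterval), 0 < (p : ℝ) → (p : ℝ) < 1 →
      ∀ (hC : Φ.CylSubcritical p), Choice κ Φ t p hC

/-- Well-formedness of a multi-type choice function. [this work] -/
def WFHoldsFnAll (𝒞₀ : ChoiceFnAll) : Prop :=
  ∀ (κ : Consts) {V : Type} [DecidableEq V] [Countable V] (G : SimpleGraph V) [G.LocallyFinite] (Φ : PlanarSkeletonSign G)
    (hg : ¬ HasExponentialGrowth G) (t : V) (ht : t ∈ Φ.types) (h0 : Φ.φ t = 0) (p : unitInterval) (hp0 : 0 < (p : ℝ)) (hp1 : (p : ℝ) < 1)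
    (hC : Φ.CylSubcritical p), (𝒞₀ κ G Φ hg t ht h0 p hp0 hp1 hC).WFHoldsAll

/-- Root obligation of a multi-type choice function. [this work] -/
def RootHoldsFnAll (𝒞₀ : ChoiceFnAll) : Prop :=
  ∀ (κ : Consts) {V : Type} [DecidableEq V] [Countable V] (G : SimpleGraph V) [G.LocallyFinite] (Φ : PlanarSkeletonSign G)
    (hg : ¬ HasExponentialGrowth G) (t : V) (ht : t ∈ Φ.types) (h0 : Φ.φ t = 0) (p : unitInterval) (hp0 : 0 < (p : ℝ)) (hp1 : (p : ℝ) < 1)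
    (hC : Φ.CylSubcritical p), (𝒞₀ κ G Φ hg t ht h0 p hp0 hp1 hC).RootHoldsAll

/-- Face obligation of a multi-type choice function. [this work] -/
def FaceHoldsRFnAll (𝒞₀ : ChoiceFnAll) : Prop :=
  ∀ (κ : Consts) {V : Type} [DecidableEq V] [Countable V] (G : SimpleGraph V) [G.LocallyFinite] (Φ : PlanarSkeletonSign G)
    (hg : ¬ HasExponentialGrowth G) (t : V) (ht : t ∈ Φ.types) (h0 : Φ.φ t = 0) (p : unitInterval) (hp0 : 0 < (p : ℝ)) (hp1 : (p : ℝ) < 1)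
    (hC : Φ.CylSubcritical p), (𝒞₀ κ G Φ hg t ht h0 p hp0 hp1 hC).FaceHoldsRAll

/-- Corridor obligation of a multi-type choice function. [this work] -/
def ReachHoldsRHFnAll (𝒞₀ : ChoiceFnAll) : Prop :=
  ∀ (κ : Consts) {V : Type} [DecidableEq V] [Countable V] (G : SimpleGraph V) [G.LocallyFinite] (Φ : PlanarSkeletonSign G)
    (hg : ¬ HasExponentialGrowth G) (t : V) (ht : t ∈ Φ.types) (h0 : Φ.φ t = 0) (p : unitInterval) (hp0 : 0 < (p : ℝ)) (hp1 : (p : ℝ) < 1)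
    (hC : Φ.CylSubcritical p), (𝒞₀ κ G Φ hg t ht h0 p hp0 hp1 hC).ReachHoldsRHAll

/-- **THE MULTI-TYPE D″ NODE FROM A CHOICE FUNCTION** (option C): a multi-type choice function whose choices are well-formed and satisfy the
three residues (all-types premises) gives `SamePDropOfSkeletonSign` — through `samePDropOfSkeletonSign_of_concSG_residuesRH'`, i.e. Step I′ with
one common band (`Skelφ.exists_stepI_ref`), Hutchcroft, Burton–Keane, `p_c < 1`, the constants and the re-centring inside.
[cite: KozmaNitzan2024, §4 Theorem 6 (pp. 25–31); §1 p. 2 (approach 1)] -/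
theorem samePDropOfSkeletonSign_of_choiceFnAll (𝒞₀ : ChoiceFnAll) (hWF : WFHoldsFnAll 𝒞₀) (hR : RootHoldsFnAll 𝒞₀) (hF : FaceHoldsRFnAll 𝒞₀)
    (hRe : ReachHoldsRHFnAll 𝒞₀) : SamePDropOfSkeletonSign := by
  refine samePDropOfSkeletonSign_of_concSG_residuesRH'
    fun K₀ δ δ₂ δr hδ0 hδ1 hδ₂0 hδ₂1 hδr {V} _ _ G _ Φ hg t ht h0 p hp0 hp1 hC => ?_
  set κ : Consts := ⟨K₀, δ, δ₂, δr, hδ0, hδ1, hδ₂0, hδ₂1, hδr⟩ with hκ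
  set 𝒞 := 𝒞₀ κ G Φ hg t ht h0 p hp0 hp1 hC with h𝒞
  refine ⟨𝒞.δI, 𝒞.m₀, 𝒞.δI_pos, fun D off M₀ n₁ hk₀ hk₁ hR' hΛ hM₀ hn₁ hGF hmono htwo => ?_⟩
  set O : Skelφ.StepI.Out V := ⟨D, off, M₀, n₁⟩ with hO
  have hfacts : O.Facts Φ.frame hC 𝒞.m₀ := ⟨hk₀, hk₁, hR', hΛ, hM₀, hn₁, hGF⟩
  obtain ⟨hSz, hSx, hSy⟩ := 𝒞.S_adm O hfacts hmono htwo
  refine ⟨𝒞.Sz O, 𝒞.Sx O, 𝒞.Sy O, hSz, hSx, hSy, fun q hq1 hq2 hin hCq => ?_⟩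
  have hat : 𝒞.AtQAll O q := ⟨hfacts, hmono, htwo, hq1, hq2, hin, hCq⟩
  obtain ⟨hwf, hK⟩ := hWF κ G Φ hg t ht h0 p hp0 hp1 hC O q hat
  exact ⟨𝒞.P O, 𝒞.Λ O q, hwf, hK, hR κ G Φ hg t ht h0 p hp0 hp1 hC O q hat, hF κ G Φ hg t ht h0 p hp0 hp1 hC O q hat,
    hRe κ G Φ hg t ht h0 p hp0 hp1 hC O q hat⟩

end PlanarSkeletonSign

end Summit.CriticalPhenomena.PercolationContinuityZ3.Theorems.Transplant

end
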